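import Summits.CriticalPhenomena.SAWScalingLimit.Theorems.SAWRenewalTightnessStripMassConservation
import Mathlib.Analysis.SpecialFunctions.Pow.Real

/-!
# Sub-goal `spanRenewalFloor_of_breakPointDensity` of the line `subcritical-renewal-floor`
(crux `TubeLowerBound`, stmt-CriticalPhenomena-4730): break-point density ⇒ Kesten's span-renewal floor

Word model of `SAWWords.lean` / `SAWWordBridges.lean` at the critical fugacity `x_c` (as in
`SAWRenewalTightnessStripMassConservation.lean`).  Write
`S_N(L) = Σ_{n ≤ N} Σ_{w ∈ sawWords n, w a bridge word of span L} x_c^n` for the (truncated) critical mass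
of the self-avoiding bridge words of span exactly `L`, and `F_N(D)` for the truncated critical mass of the
bridge words `w` with span in `[D, 2D)` all of whose break points (`IsBreak w j`) lie at levels
`x(j) < D`.  HYPOTHESIS ("break-point density", the anti-lacunarity (A) of Kesten's critical span
renewal): for some `c₀ > 0` and every `D ≥ 1`, `F_N(D) ≥ c₀` for some `N`.  CONCLUSION (Kesten's
span-renewal floor in word form): `S_N(L) ≥ c L^{-C}` for some `N = N(L)`, all `L ≥ 1`.

PROOF ("renewal halving", cost `c₀` per dyadic level).  GLUING (`glue`): for `D = ⌈L/2⌉` the map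
`(w, v) ↦ w ++ v` from pairs (`w ∈ F(D)`, `v` a bridge word of span `L - span w ∈ [0, L/2]`) to bridge
words of span `L` is well defined (`IsSAW.append_of_bridge`, `IsBridgeW.append`, `xEnd_append`) and
INJECTIVE (`eq_of_append_eq_of_breaks`, Kesten's unique decoding: if `w` were a proper prefix of `w'` then
`|w|` would be a break point of `w'` at level `span w ≥ D`, `isBreak_length_of_prefix`), and the weights
multiply; hence `S_{N₁+N₂}(L) ≥ F_{N₁}(D) · min_{0 ≤ r ≤ L/2} S_{N₂}(r)`.  By induction over the dyadic
scale `k` (`L < 2^{k+1}`): `S_N(L) ≥ x_c c₁^{k+1}` with `c₁ = min(c₀, 1)` (base: the one-step bridge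
`[+e₀]`, `S_1(1) ≥ x_c`; span `0`: the empty word, `S_N(0) ≥ 1 ≥ x_c c₁^{k+1}`).  Finally
`c₁^{⌊log₂ L⌋} ≥ (1/2)^{K ⌊log₂ L⌋} ≥ L^{-K}` once `(1/2)^K ≤ c₁`, giving `C = K`, `c = x_c c₁`.

References: H. Kesten, *On the number of self-avoiding walks*, J. Math. Phys. 4 (1963), §4 (break
points, unique factorisation of bridges, the span renewal); N. Madras, G. Slade, *The Self-Avoiding Walk*
(1993), §4.2, (4.2.1)–(4.2.12).
-/

noncomputable section

namespace Summit.CriticalPhenomena.SAWScalingLimit.Theorems.TubeLowerBound.SubcriticalRenewalFloor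

open scoped BigOperators Classical
open Literature.Probability.LatticeModels
open Literature.Probability.RandomPlanarGeometry Literature.Probability.RandomPlanarGeometry.SAW

namespace SpanFloor

open Finset

/-! ### Truncated critical masses of word classes: bookkeeping -/

/-- The double sum `Σ_{n ≤ N} Σ_{w ∈ sawWords n, P w} x_c^n` is the sum of `x_c^{|w|}` over the
self-avoiding words of length `≤ N` satisfying `P`. [folklore] -/
theorem sum_range_filter_eq (P : List Step → Prop) [DecidablePred P] (N : ℕ) :
    ∑ n ∈ Finset.range (N + 1), ∑ _w ∈ (sawWords n).filter P, criticalFugacity ^ n =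
      ∑ w ∈ (Finset.range (N + 1)).biUnion (fun n => (sawWords n).filter P),
        criticalFugacity ^ w.length := by
  have hdisj : Set.PairwiseDisjoint (↑(Finset.range (N + 1)) : Set ℕ)
      (fun n => (sawWords n).filter P) := by
    intro m _ n _ hmn
    rw [Function.onFun, Finset.disjoint_left]
    intro w hwm hwn
    exact hmn ((mem_sawWords.1 (Finset.mem_filter.1 hwm).1).1.symm.trans
      (mem_sawWords.1 (Finset.mem_filter.1 hwn).1).1)
  rw [Finset.sum_biUnion hdisj]
  refine Finset.sum_congr rfl fun n _ => Finset.sum_congr rfl fun w hw => ?_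
  rw [(mem_sawWords.1 (Finset.mem_filter.1 hw).1).1]

/-- Membership in the set of self-avoiding words of length `≤ N` satisfying `P`. [folklore] -/
theorem mem_biUnion_filter {P : List Step → Prop} [DecidablePred P] {N : ℕ} {w : List Step} :
    w ∈ (Finset.range (N + 1)).biUnion (fun n => (sawWords n).filter P) ↔
      w.length ≤ N ∧ IsSAW w ∧ P w := by
  simp only [Finset.mem_biUnion, Finset.mem_range, Finset.mem_filter, mem_sawWords]
  constructor
  · rintro ⟨n, hn, ⟨hl, hs⟩, hp⟩
    exact ⟨by omega, hs, hp⟩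
  · rintro ⟨hl, hs, hp⟩
    exact ⟨w.length, by omega, ⟨rfl, hs⟩, hp⟩

/-- The truncated masses are monotone in the cut-off `N`. [folklore] -/
theorem sum_range_filter_mono (P : List Step → Prop) [DecidablePred P] {N N' : ℕ} (h : N ≤ N') :
    ∑ n ∈ Finset.range (N + 1), ∑ _w ∈ (sawWords n).filter P, criticalFugacity ^ n ≤
      ∑ n ∈ Finset.range (N' + 1), ∑ _w ∈ (sawWords n).filter P, criticalFugacity ^ n :=
  Finset.sum_le_sum_of_subset_of_nonneg (Finset.range_subset_range.2 (by omega)) fun _ _ _ =>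
    Finset.sum_nonneg fun _ _ => pow_nonneg StripMass.criticalFugacity_pos.le _

/-- Span `0`: the empty word is a bridge word of span `0`, so `S_N(0) ≥ 1`. [folklore] -/
theorem one_le_sum_span_zero (N : ℕ) :
    1 ≤ ∑ n ∈ Finset.range (N + 1),
      ∑ _w ∈ (sawWords n).filter (fun w => IsBridgeW w ∧ xEnd w = ((0 : ℕ) : ℤ)),
        criticalFugacity ^ n := by
  have hxc : 0 ≤ criticalFugacity := StripMass.criticalFugacity_pos.le
  have h0 : (0 : ℕ) ∈ Finset.range (N + 1) := Finset.mem_range.2 (Nat.succ_pos N)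
  have hnil : ([] : List Step) ∈
      (sawWords 0).filter (fun w => IsBridgeW w ∧ xEnd w = ((0 : ℕ) : ℤ)) :=
    Finset.mem_filter.2 ⟨mem_sawWords.2 ⟨rfl, isSAW_nil⟩, isBridgeW_nil, by simp [xEnd]⟩
  calc (1 : ℝ) = criticalFugacity ^ 0 := (pow_zero _).symm
    _ ≤ ∑ _w ∈ (sawWords 0).filter (fun w => IsBridgeW w ∧ xEnd w = ((0 : ℕ) : ℤ)),
          criticalFugacity ^ 0 :=
        Finset.single_le_sum (f := fun _ : List Step => criticalFugacity ^ 0)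
          (fun _ _ => pow_nonneg hxc _) hnil
    _ ≤ _ :=
        Finset.single_le_sum (f := fun n => ∑ _w ∈ (sawWords n).filter
            (fun w => IsBridgeW w ∧ xEnd w = ((0 : ℕ) : ℤ)), criticalFugacity ^ n)
          (fun _ _ => Finset.sum_nonneg fun _ _ => pow_nonneg hxc _) h0

/-- Span `1`: the one-step bridge `[+e₀]`, so `S_1(1) ≥ x_c`. [folklore] -/
theorem criticalFugacity_le_sum_span_one :
    criticalFugacity ≤ ∑ n ∈ Finset.range (1 + 1),
      ∑ _w ∈ (sawWords n).filter (fun w => IsBridgeW w ∧ xEnd w = ((1 : ℕ) : ℤ)),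
        criticalFugacity ^ n := by
  have hxc : 0 ≤ criticalFugacity := StripMass.criticalFugacity_pos.le
  have h1 : (1 : ℕ) ∈ Finset.range (1 + 1) := Finset.mem_range.2 (by norm_num)
  have hx1 : xEnd [(0 : Step)] = 1 := by decide
  have hE : [(0 : Step)] ∈
      (sawWords 1).filter (fun w => IsBridgeW w ∧ xEnd w = ((1 : ℕ) : ℤ)) :=
    Finset.mem_filter.2 ⟨mem_sawWords.2 ⟨rfl, Renewal.isIrrBridge_single.saw⟩,
      Renewal.isIrrBridge_single.bridge, by rw [hx1, Nat.cast_one]⟩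
  calc criticalFugacity = criticalFugacity ^ 1 := (pow_one _).symm
    _ ≤ ∑ _w ∈ (sawWords 1).filter (fun w => IsBridgeW w ∧ xEnd w = ((1 : ℕ) : ℤ)),
          criticalFugacity ^ 1 :=
        Finset.single_le_sum (f := fun _ : List Step => criticalFugacity ^ 1)
          (fun _ _ => pow_nonneg hxc _) hE
    _ ≤ _ :=
        Finset.single_le_sum (f := fun n => ∑ _w ∈ (sawWords n).filter
            (fun w => IsBridgeW w ∧ xEnd w = ((1 : ℕ) : ℤ)), criticalFugacity ^ n)
          (fun _ _ => Finset.sum_nonneg fun _ _ => pow_nonneg hxc _) h1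

/-! ### Unique decoding for words whose break points lie below level `D` -/

/-- **Unique decoding below the break level.** If `w ++ v = w' ++ v'` where `v, v'` are bridges and
`w, w'` are bridges of span `≥ D ≥ 1` all of whose break points lie at levels `< D`, then `w = w'`:
otherwise (say `|w| < |w'|`) `|w|` would be a break point of `w'` at level `span w ≥ D`
(`isBreak_length_of_prefix`). [cite: Kesten1963SAW, §4] -/
theorem eq_of_append_eq_of_breaks {D : ℤ} (hD : 1 ≤ D) {w w' v v' : List Step}
    (hw : IsBridgeW w) (hwD : D ≤ xEnd w) (hwb : ∀ j, IsBreak w j → xAt w j < D)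
    (hw' : IsBridgeW w') (hw'D : D ≤ xEnd w') (hw'b : ∀ j, IsBreak w' j → xAt w' j < D)
    (hv : IsBridgeW v) (hv' : IsBridgeW v') (h : w ++ v = w' ++ v') : w = w' := by
  -- adapted from `SAW.eq_of_append_eq` (irreducible first factors) of `SAWWordBridges.lean`
  wlog hle : w.length ≤ w'.length generalizing w w' v v'
  · exact (this hw' hw'D hw'b hw hwD hwb hv' hv h.symm (by omega)).symm
  rcases hle.eq_or_lt with heq | hlt
  · exact List.append_inj_left h heq
  · exfalso
    set u := w'.drop w.length with hu_def
    have e1 : w'.take w.length = w := by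
      have := congrArg (List.take w.length) h
      rwa [List.take_append_of_le_length le_rfl, List.take_length,
        List.take_append_of_le_length hle, eq_comm] at this
    have e2 : w' = w ++ u := by
      conv_lhs => rw [← List.take_append_drop w.length w']
      rw [e1]
    have e3 : v = u ++ v' := by
      have := congrArg (List.drop w.length) h
      rwa [List.drop_left, List.drop_append_of_le_length hle] at this
    have hu : u ≠ [] := by
      rw [ne_eq, ← List.length_eq_zero_iff, hu_def, List.length_drop]; omega
    have hne : w ≠ [] := by
      rintro rfl
      have : xEnd ([] : List Step) = 0 := by simp [xEnd]
      omega
    have hb := isBreak_length_of_prefix hw hne hu (e3 ▸ hv)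
    rw [← e2] at hb
    have h1 := hw'b _ hb
    rw [e2, xAt_append_left w u le_rfl, ← xEnd] at h1
    omega

/-! ### Gluing: renewal halving -/

/-- **Gluing inequality.** Let `1 ≤ D`, `2D ≤ L + 1`, and suppose the bridge words of every span
`r ≤ L - D` have truncated critical mass `S_{N₂}(r) ≥ m`.  Appending to each word `w` of the
break-point-density family at scale `D` (span in `[D, 2D)`, all break points below `D`, length `≤ N₁`)
a bridge word of span `L - span w` produces DISTINCT (`eq_of_append_eq_of_breaks`) self-avoiding bridge
words of span `L` and length `≤ N₁ + N₂`, with multiplicative weights; hence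
`F_{N₁}(D) · m ≤ S_{N₁+N₂}(L)`. [cite: MadrasSlade1993, §4.2, (4.2.1)–(4.2.2)] -/
theorem glue {D L N₁ N₂ : ℕ} {m : ℝ} (hD : 1 ≤ D) (hDL : 2 * D ≤ L + 1)
    (hm : ∀ r : ℕ, r + D ≤ L → m ≤ ∑ n ∈ Finset.range (N₂ + 1),
      ∑ _w ∈ (sawWords n).filter (fun w => IsBridgeW w ∧ xEnd w = (r : ℤ)), criticalFugacity ^ n) :
    (∑ n ∈ Finset.range (N₁ + 1), ∑ _w ∈ (sawWords n).filter (fun w => IsBridgeW w ∧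
        (D : ℤ) ≤ xEnd w ∧ xEnd w < 2 * (D : ℤ) ∧ ∀ j, IsBreak w j → xAt w j < (D : ℤ)),
        criticalFugacity ^ n) * m ≤
      ∑ n ∈ Finset.range (N₁ + N₂ + 1),
        ∑ _w ∈ (sawWords n).filter (fun w => IsBridgeW w ∧ xEnd w = (L : ℤ)),
          criticalFugacity ^ n := by
  have hxc : 0 < criticalFugacity := StripMass.criticalFugacity_pos
  have hD' : (1 : ℤ) ≤ (D : ℤ) := by exact_mod_cast hD
  rw [sum_range_filter_eq, sum_range_filter_eq]
  set F : Finset (List Step) := (Finset.range (N₁ + 1)).biUnion (fun n => (sawWords n).filter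
    (fun w => IsBridgeW w ∧ (D : ℤ) ≤ xEnd w ∧ xEnd w < 2 * (D : ℤ) ∧
      ∀ j, IsBreak w j → xAt w j < (D : ℤ))) with hF
  have memF : ∀ w ∈ F, w.length ≤ N₁ ∧ IsSAW w ∧ IsBridgeW w ∧ (D : ℤ) ≤ xEnd w ∧
      xEnd w < 2 * (D : ℤ) ∧ ∀ j, IsBreak w j → xAt w j < (D : ℤ) := fun w hw => by
    rw [hF, mem_biUnion_filter] at hw
    exact ⟨hw.1, hw.2.1, hw.2.2⟩
  calc (∑ w ∈ F, criticalFugacity ^ w.length) * m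
      = ∑ w ∈ F, criticalFugacity ^ w.length * m := Finset.sum_mul _ _ _
    _ ≤ ∑ w ∈ F, criticalFugacity ^ w.length *
          ∑ v ∈ (Finset.range (N₂ + 1)).biUnion (fun n => (sawWords n).filter
            (fun v => IsBridgeW v ∧ xEnd v = (L : ℤ) - xEnd w)), criticalFugacity ^ v.length := by
        refine Finset.sum_le_sum fun w hw => mul_le_mul_of_nonneg_left ?_ (pow_nonneg hxc.le _)
        obtain ⟨-, -, -, hDw, hw2D, -⟩ := memF w hw
        obtain ⟨r, hr⟩ : ∃ r : ℕ, (L : ℤ) - xEnd w = r := Int.eq_ofNat_of_zero_le (by omega)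
        have key := hm r (by omega)
        rw [sum_range_filter_eq] at key
        rw [hr]
        exact key
    _ = ∑ p ∈ F.sigma (fun w => (Finset.range (N₂ + 1)).biUnion (fun n => (sawWords n).filter
            (fun v => IsBridgeW v ∧ xEnd v = (L : ℤ) - xEnd w))),
          criticalFugacity ^ (p.1 ++ p.2).length := by
        rw [Finset.sum_sigma]
        simp only [List.length_append, pow_add, Finset.mul_sum]
    _ = ∑ u ∈ (F.sigma (fun w => (Finset.range (N₂ + 1)).biUnion (fun n => (sawWords n).filter
            (fun v => IsBridgeW v ∧ xEnd v = (L : ℤ) - xEnd w)))).image (fun p => p.1 ++ p.2),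
          criticalFugacity ^ u.length := by
        rw [Finset.sum_image]
        rintro ⟨w, v⟩ hp ⟨w', v'⟩ hp' heq
        rw [Finset.mem_coe, Finset.mem_sigma] at hp hp'
        change w ++ v = w' ++ v' at heq
        obtain ⟨-, -, hbw, hDw, -, hbrw⟩ := memF w hp.1
        obtain ⟨-, -, hbw', hDw', -, hbrw'⟩ := memF w' hp'.1
        have hv := (mem_biUnion_filter.1 hp.2).2.2.1
        have hv' := (mem_biUnion_filter.1 hp'.2).2.2.1
        obtain rfl : w = w' := eq_of_append_eq_of_breaks hD' hbw hDw hbrw hbw' hDw' hbrw' hv hv' heq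
        obtain rfl : v = v' := List.append_cancel_left heq
        rfl
    _ ≤ _ := by
        refine Finset.sum_le_sum_of_subset_of_nonneg ?_ fun _ _ _ => pow_nonneg hxc.le _
        rw [Finset.image_subset_iff]
        rintro ⟨w, v⟩ hp
        rw [Finset.mem_sigma] at hp
        obtain ⟨hlw, hsw, hbw, -, -, -⟩ := memF w hp.1
        obtain ⟨hlv, hsv, hbv, hxv⟩ :
            v.length ≤ N₂ ∧ IsSAW v ∧ IsBridgeW v ∧ xEnd v = (L : ℤ) - xEnd w :=
          mem_biUnion_filter.1 hp.2
        show w ++ v ∈ _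
        refine mem_biUnion_filter.2 ⟨?_, IsSAW.append_of_bridge hsw hsv hbw hbv, hbw.append hbv, ?_⟩
        · rw [List.length_append]; omega
        · rw [xEnd_append, hxv]; ring

end SpanFloor

/-- **Break-point density ⇒ Kesten's span-renewal floor** (registered sub-goal
`spanRenewalFloor_of_breakPointDensity` of the crux item, census link "(A) anti-lacunarity ⇒ span
floor").  If for some `c₀ > 0` and every `D ≥ 1` the critical mass of the bridge words with span in
`[D, 2D)` all of whose break points lie below level `D` is `≥ c₀`, then the critical mass of the bridge
words of span exactly `L` is `≥ c L^{-C}` (`C ≥ 0`, `c > 0`) for every `L ≥ 1`: renewal halving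
(`SpanFloor.glue`) costs a factor `min(c₀, 1)` per dyadic scale. [cite: Kesten1963SAW, §4] -/
theorem spanRenewalFloor_of_breakPointDensity :
    (∃ c₀ : ℝ, 0 < c₀ ∧ ∀ D : ℕ, 1 ≤ D → ∃ N : ℕ, c₀ ≤ ∑ n ∈ Finset.range (N + 1), ∑ _w ∈ (sawWords n).filter (fun w => IsBridgeW w ∧ (D : ℤ) ≤ xEnd w ∧ xEnd w < 2 * (D : ℤ) ∧ ∀ j, IsBreak w j → xAt w j < (D : ℤ)), criticalFugacity ^ n) → ∃ C c : ℝ, 0 ≤ C ∧ 0 < c ∧ ∀ L : ℕ, 1 ≤ L → ∃ N : ℕ, c * (L : ℝ) ^ (-C) ≤ ∑ n ∈ Finset.range (N + 1), ∑ _w ∈ (sawWords n).filter (fun w => IsBridgeW w ∧ xEnd w = (L : ℤ)), criticalFugacity ^ n := by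
  rintro ⟨c₀, hc₀, hBPD⟩
  have hxc : 0 < criticalFugacity := StripMass.criticalFugacity_pos
  have hxc1 : criticalFugacity ≤ 1 := by
    have h := Zd.one_le_connectiveConstant 2
    rw [Zd.connectiveConstant_two] at h
    exact inv_le_one_of_one_le₀ h
  set c₁ : ℝ := min c₀ 1 with hc₁
  have hc₁0 : 0 < c₁ := lt_min hc₀ one_pos
  have hc₁1 : c₁ ≤ 1 := min_le_right _ _
  have hc₁c₀ : c₁ ≤ c₀ := min_le_left _ _
  -- renewal halving, by induction over the dyadic scale `k`
  have key : ∀ k L : ℕ, 1 ≤ L → L < 2 ^ (k + 1) → ∃ N : ℕ,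
      criticalFugacity * c₁ ^ (k + 1) ≤ ∑ n ∈ Finset.range (N + 1),
        ∑ _w ∈ (sawWords n).filter (fun w => IsBridgeW w ∧ xEnd w = (L : ℤ)),
          criticalFugacity ^ n := by
    intro k
    induction k with
    | zero =>
      intro L hL1 hL2
      obtain rfl : L = 1 := by simp at hL2; omega
      refine ⟨1, le_trans ?_ SpanFloor.criticalFugacity_le_sum_span_one⟩
      rw [zero_add, pow_one]
      exact mul_le_of_le_one_right hxc.le hc₁1
    | succ k ih =>
      intro L hL1 hL2
      by_cases hlt : L < 2 ^ (k + 1)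
      · obtain ⟨N, hN⟩ := ih L hL1 hlt
        refine ⟨N, le_trans ?_ hN⟩
        rw [pow_succ c₁ (k + 1)]
        exact mul_le_mul_of_nonneg_left (mul_le_of_le_one_right (pow_nonneg hc₁0.le _) hc₁1) hxc.le
      · push Not at hlt
        set D : ℕ := L - L / 2 with hD
        have hD1 : 1 ≤ D := by omega
        have hDL : 2 * D ≤ L + 1 := by omega
        have hLD : L - D < 2 ^ (k + 1) := by rw [pow_succ] at hL2; omega
        obtain ⟨N₁, hN₁⟩ := hBPD D hD1
        -- the remainders `r < 2^(k+1)`: `r = 0` by the empty word, `r ≥ 1` by induction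
        have hrem : ∀ r : ℕ, r < 2 ^ (k + 1) → ∃ N : ℕ,
            criticalFugacity * c₁ ^ (k + 1) ≤ ∑ n ∈ Finset.range (N + 1),
              ∑ _w ∈ (sawWords n).filter (fun w => IsBridgeW w ∧ xEnd w = (r : ℤ)),
                criticalFugacity ^ n := by
          intro r hr
          rcases Nat.eq_zero_or_pos r with rfl | hr0
          · refine ⟨0, le_trans ?_ (SpanFloor.one_le_sum_span_zero 0)⟩
            exact mul_le_one₀ hxc1 (pow_nonneg hc₁0.le _) (pow_le_one₀ hc₁0.le hc₁1)
          · exact ih r hr0 hr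
        choose! Nf hNf using hrem
        set N₂ : ℕ := (Finset.range (2 ^ (k + 1))).sup Nf with hN₂
        refine ⟨N₁ + N₂, ?_⟩
        have hglue := SpanFloor.glue (N₁ := N₁) (N₂ := N₂) (m := criticalFugacity * c₁ ^ (k + 1))
          hD1 hDL (fun r hr => (hNf r (by omega)).trans (SpanFloor.sum_range_filter_mono _
            (Finset.le_sup (f := Nf) (Finset.mem_range.2 (by omega)))))
        calc criticalFugacity * c₁ ^ (k + 1 + 1) = c₁ * (criticalFugacity * c₁ ^ (k + 1)) := by ring
          _ ≤ (∑ n ∈ Finset.range (N₁ + 1), ∑ _w ∈ (sawWords n).filter (fun w => IsBridgeW w ∧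
                (D : ℤ) ≤ xEnd w ∧ xEnd w < 2 * (D : ℤ) ∧ ∀ j, IsBreak w j → xAt w j < (D : ℤ)),
                criticalFugacity ^ n) * (criticalFugacity * c₁ ^ (k + 1)) :=
              mul_le_mul_of_nonneg_right (hc₁c₀.trans hN₁)
                (mul_nonneg hxc.le (pow_nonneg hc₁0.le (k + 1)))
          _ ≤ _ := hglue
  -- the exponent: `(1/2)^K ≤ c₁` gives `c₁^{⌊log₂ L⌋} ≥ L^{-K}`
  obtain ⟨K, hK⟩ := exists_pow_lt_of_lt_one hc₁0 (by norm_num : (1 / 2 : ℝ) < 1)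
  refine ⟨K, criticalFugacity * c₁, Nat.cast_nonneg K, mul_pos hxc hc₁0, fun L hL => ?_⟩
  obtain ⟨N, hN⟩ := key (Nat.log 2 L) L hL (Nat.lt_pow_succ_log_self one_lt_two L)
  refine ⟨N, le_trans ?_ hN⟩
  have h2k : 2 ^ Nat.log 2 L ≤ L := Nat.pow_log_le_self 2 (by omega)
  have hL0 : (0 : ℝ) < L := by exact_mod_cast hL
  have hpow : (L : ℝ) ^ (-(K : ℝ)) ≤ c₁ ^ Nat.log 2 L := by
    rw [Real.rpow_neg hL0.le, Real.rpow_natCast]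
    calc ((L : ℝ) ^ K)⁻¹ ≤ (((2 : ℝ) ^ Nat.log 2 L) ^ K)⁻¹ := by
          refine inv_anti₀ (pow_pos (pow_pos two_pos _) _) ?_
          exact pow_le_pow_left₀ (by positivity) (by exact_mod_cast h2k) K
      _ = ((1 / 2 : ℝ) ^ K) ^ Nat.log 2 L := by
          rw [← pow_mul, ← pow_mul, mul_comm, one_div, inv_pow]
      _ ≤ c₁ ^ Nat.log 2 L := pow_le_pow_left₀ (by positivity) hK.le _
  calc criticalFugacity * c₁ * (L : ℝ) ^ (-(K : ℝ))
      ≤ criticalFugacity * c₁ * c₁ ^ Nat.log 2 L :=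
        mul_le_mul_of_nonneg_left hpow (mul_nonneg hxc.le hc₁0.le)
    _ = criticalFugacity * c₁ ^ (Nat.log 2 L + 1) := by ring

end Summit.CriticalPhenomena.SAWScalingLimit.Theorems.TubeLowerBound.SubcriticalRenewalFloor

end
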